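import Summits.CriticalPhenomena.CardyFormulaZ2.Theorems.CardyQContinuationUniformZeroFreeJetsEnvelope

/-!
# `UniformZeroFree` ⇔ arc zero-freeness ∧ uniform real jets (crux stmt-CriticalPhenomena-5559)

Notation of the route `CardyQContinuation`: for a conformal rectangle `R`, mesh `δ` and complex
`s`, `w_s(ω) = s^(|ω| + 2 k_B(ω))` is the self-dual arc weight of a bond configuration
`ω ⊆ E(Ω_δ)` (arcs `(ab)_δ ∪ (cd)_δ` jointly wired), `Z_δ(s) = Σ_ω w_s(ω)` the arc partition
function, `N_δ(s)` its crossing-restricted part, `P_δ = N_δ/Z_δ` the crossing ratio and `T_ρ` the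
complex `ρ`-neighbourhood of the real segment `s ∈ [1, √2]`.  The crux `UniformZeroFree` asks for
`ρ > 0` and `M` with `Z_δ ≠ 0` and `‖P_δ‖ ≤ M` on `T_ρ` for all small `δ` (uniformly in `δ`).

The lead's line `registered` (skeleton `Cruxes/UniformZeroFree/Lines/birth.lean`, v2) cuts the crux
into the two registered stubs

* `stub_arcZeroFree` — FISHER-ZERO CONTENT: `∃ ρ > 0`, for all small `δ`, `Z_δ ≠ 0` on `T_ρ`;
* `stub_jetsBounded` — AMPLITUDE CONTENT at REAL points: `∃ M A`, `0 ≤ A`, for all small `δ`, all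
  real `t ∈ [1, √2]` and all orders `k`, `‖P_δ^{(k)}(t)‖ ≤ M · k! · A^k` (the `k`-th jet of
  `log`-odds at a real point is a difference of `k`-th conditional cumulants of `L = |ω| + 2k_B`
  under the critical FK measure `φ_t` given no-crossing resp. crossing; `k = 1, t = 1` is the route
  item `FirstJetAtOneBounded`, stmt-CriticalPhenomena-7102, via `jets_firstJetAtOneBounded`).

This file lands the line's COMPOSITION as theorems of the tree, so that the reduction is available
BY NAME independently of the (sorried) skeleton workfile:

* `reduction_norm_le_of_jets` — Taylor summation: factorially bounded jets at `t` and holomorphy on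
  a disc give `‖f(s)‖ ≤ 2M` for `A|s − t| ≤ 1/2` (`Complex.hasSum_taylorSeries_on_ball`);
* `uniformZeroFree_of_arcZeroFree_of_jetsBounded` — the two stubs imply the crux, with
  `ρ = min ρ₁ (1/(2(A+1)))` and bound `2M` (every `s ∈ T_ρ` is within `ρ` of a real `t ∈ [1, √2]`,
  the disc `|z − t| < ρ₁` lies in `T_{ρ₁}` where `Z_δ ≠ 0`, so `P_δ` is holomorphic there and equals
  its Taylor series at `t`);
* `arcZeroFree_of_uniformZeroFree` — the crux implies the first stub (its first conjunct);
* `uniformZeroFree_iff_arcZeroFree_and_jetsBounded` — with the Cauchy converse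
  `jetsBounded_of_uniformZeroFree` (file `…UniformZeroFreeJets`): the crux is EQUIVALENT to the
  conjunction of the two stubs.  Consequently the crux inherits every necessary condition of either
  stub (e.g. `FirstJetAtOneBounded`, `firstJetAtOneBounded_of_uniformZeroFree`), and a refutation of
  either stub refutes the crux.

Both stubs are written on the `dsimp only`-normal form of the route's `let w; let Z; let N`
bindings (the form in which they are registered on the item), so the statements below speak about
literally the same terms as the skeleton.  Status (lead c2, 2026-08-17): both stubs are open —
their pointwise-in-`δ` versions are theorems (`arcZ_pointwise`, `jets_pointwise`), the whole
content of each is uniformity in `δ` at a critical point, for which no mechanism exists in print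
(bulk free energy along the self-dual line: Baxter, and rigorously arXiv:2012.11675 Thm 1 via the
six-vertex model at `Δ = −√q/2`; fixed-width strip loci on `Q = v²`: Chang–Shrock
cond-mat/0602178; neither controls boundary/amplitude zeros uniformly in the width).
-/

namespace Summit.CriticalPhenomena.CardyFormulaZ2.Theorems.UniformZeroFree

open Filter Metric Set
open scoped Topology Nat
open Literature.Probability.LatticeModels Literature.Probability.Percolation
open Literature.Probability.RandomPlanarGeometry
open Summit.CriticalPhenomena.CardyFormulaZ2.Theorems.CardyQContinuation
open Summit.CriticalPhenomena.CardyFormulaZ2.Theses.CardyQContinuation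

/-- **Taylor bound from factorially bounded jets.** If `f` is complex differentiable on the disc
`|z − t| < R`, its jets at `t` satisfy `‖f^{(k)}(t)‖ ≤ M · k! · A^k` (`M, A ≥ 0`), and `s` lies in the
disc with `A · |s − t| ≤ 1/2`, then `‖f(s)‖ ≤ 2M`: sum the Taylor series
(`Complex.hasSum_taylorSeries_on_ball`) against the geometric series `M Σ 2^{-k}`.  (The glue lemma
of the line `registered`, skeleton v2.) [folklore] -/
theorem reduction_norm_le_of_jets {f : ℂ → ℂ} {t : ℂ} {R M A : ℝ}
    (hf : DifferentiableOn ℂ f (Metric.ball t R)) (hM : 0 ≤ M) (hA : 0 ≤ A)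
    (hj : ∀ k : ℕ, ‖iteratedDeriv k f t‖ ≤ M * (k.factorial : ℝ) * A ^ k)
    {s : ℂ} (hs : s ∈ Metric.ball t R) (hsA : A * ‖s - t‖ ≤ 1 / 2) : ‖f s‖ ≤ 2 * M := by
  have hsum := Complex.hasSum_taylorSeries_on_ball hf hs
  have hgeo : HasSum (fun k : ℕ ↦ M * (1 / 2 : ℝ) ^ k) (M * (1 - 1 / 2)⁻¹) :=
    (hasSum_geometric_of_lt_one (by norm_num) (by norm_num)).mul_left M
  have h2 : M * (1 - 1 / 2 : ℝ)⁻¹ = 2 * M := by norm_num; ring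
  rw [← h2]
  refine hsum.norm_le_of_bounded hgeo fun k ↦ ?_
  rw [norm_smul, norm_smul, norm_inv, Complex.norm_natCast, norm_pow]
  have hk : (0 : ℝ) < k.factorial := by exact_mod_cast k.factorial_pos
  have hst : 0 ≤ A * ‖s - t‖ := mul_nonneg hA (norm_nonneg _)
  calc (k.factorial : ℝ)⁻¹ * (‖s - t‖ ^ k * ‖iteratedDeriv k f t‖)
      ≤ (k.factorial : ℝ)⁻¹ * (‖s - t‖ ^ k * (M * (k.factorial : ℝ) * A ^ k)) := by
        gcongr
        exact hj k
    _ = M * (A * ‖s - t‖) ^ k := by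
        rw [mul_pow]; field_simp
    _ ≤ M * (1 / 2) ^ k := by
        gcongr

/-- A point of `T_ρ` is within `ρ` of some real `t ∈ [1, √2]`. [folklore] -/
theorem reduction_exists_real_near_of_mem_thickening {ρ : ℝ} {s : ℂ}
    (hs : s ∈ Metric.thickening ρ (((↑) : ℝ → ℂ) '' Set.Icc (1:ℝ) (Real.sqrt 2))) :
    ∃ t ∈ Set.Icc (1:ℝ) (Real.sqrt 2), dist s (t : ℂ) < ρ := by
  rw [Metric.mem_thickening_iff] at hs
  obtain ⟨_, ⟨t, ht, rfl⟩, hst⟩ := hs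
  exact ⟨t, ht, hst⟩

/-- **The two stubs imply the crux** (`stub_arcZeroFree → stub_jetsBounded → UniformZeroFree`, the
composition of the line `registered`, skeleton v2, kernel-checked): given `ρ₁` with `Z_δ ≠ 0` on
`T_{ρ₁}` and `M, A` bounding the real jets, take `ρ = min ρ₁ (1/(2(A+1)))`; for `s ∈ T_ρ` pick a real
`t ∈ [1, √2]` with `|s − t| < ρ`; `P_δ = N_δ/Z_δ` is holomorphic on the disc `|z − t| < ρ₁ ⊆ T_{ρ₁}`
(finitely many configurations for `δ > 0`, `differentiableOn_ratio`), and the Taylor bound gives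
`‖P_δ(s)‖ ≤ 2M`. [folklore] -/
theorem uniformZeroFree_of_arcZeroFree_of_jetsBounded : (∀ R : Literature.Probability.RandomPlanarGeometry.ConformalRectangle, ∃ ρ > (0:ℝ), ∀ᶠ δ in nhdsWithin (0:ℝ) (Set.Ioi 0), ∀ s ∈ Metric.thickening ρ (((↑) : ℝ → ℂ) '' Set.Icc (1:ℝ) (Real.sqrt 2)), (∑ᶠ ω ∈ 𝒫 (Literature.Probability.LatticeModels.discreteDomainGraph R.carrier δ).edgeSet, s ^ (ω.ncard + 2 * Nat.card ((Literature.Probability.Percolation.openGraph ω ⊔ Literature.Probability.LatticeModels.wired (Literature.Probability.LatticeModels.discreteArc R.carrier δ (R.arc 0) ∪ Literature.Probability.LatticeModels.discreteArc R.carrier δ (R.arc 2))).induce (Literature.Probability.LatticeModels.meshDomain R.carrier δ)).ConnectedComponent)) ≠ 0) → (∀ R : Literature.Probability.RandomPlanarGeometry.ConformalRectangle, ∃ M A : ℝ, 0 ≤ A ∧ ∀ᶠ δ in nhdsWithin (0:ℝ) (Set.Ioi 0), ∀ t ∈ Set.Icc (1:ℝ) (Real.sqrt 2), ∀ k : ℕ,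 ‖iteratedDeriv k (fun s ↦ (∑ᶠ ω ∈ 𝒫 (Literature.Probability.LatticeModels.discreteDomainGraph R.carrier δ).edgeSet, (Literature.Probability.Percolation.discreteCrossing R.carrier δ (R.arc 0) (R.arc 2)).indicator (fun ω ↦ s ^ (ω.ncard + 2 * Nat.card ((Literature.Probability.Percolation.openGraph ω ⊔ Literature.Probability.LatticeModels.wired (Literature.Probability.LatticeModels.discreteArc R.carrier δ (R.arc 0) ∪ Literature.Probability.LatticeModels.discreteArc R.carrier δ (R.arc 2))).induce (Literature.Probability.LatticeModels.meshDomain R.carrier δ)).ConnectedComponent)) ω) / (∑ᶠ ω ∈ 𝒫 (Literature.Probability.LatticeModels.discreteDomainGraph R.carrier δ).edgeSet, s ^ (ω.ncard + 2 * Nat.card ((Literature.Probability.Percolation.openGraph ω ⊔ Literature.Probability.LatticeModels.wired (Literature.Probability.LatticeModels.discreteArc R.carrier δ (R.arc 0) ∪ Literature.Probability.LatticeModels.discreteArc R.carrier δ (R.arc 2))).induce (Literature.Probability.LatticeModels.meshDomain R.carrier δ)).ConnectedComponent))) (t : ℂ)‖ ≤ M * (k.factorial : ℝ) * A ^ k)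 → Summit.CriticalPhenomena.CardyFormulaZ2.Theses.CardyQContinuation.UniformZeroFree := by
  intro h1 h2
  dsimp only [Summit.CriticalPhenomena.CardyFormulaZ2.Theses.CardyQContinuation.UniformZeroFree]
  intro R
  obtain ⟨ρ₁, hρ₁, h1R⟩ := h1 R
  obtain ⟨M, A, hA, h2R⟩ := h2 R
  have hA1 : 0 < 2 * (A + 1) := by positivity
  set ρ : ℝ := min ρ₁ (1 / (2 * (A + 1))) with hρdef
  have hρ : 0 < ρ := lt_min hρ₁ (by positivity)
  refine ⟨ρ, hρ, 2 * M, ?_⟩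
  have hpos : ∀ᶠ δ in 𝓝[>] (0 : ℝ), 0 < δ := self_mem_nhdsWithin
  filter_upwards [h1R, h2R, hpos] with δ hδ1 hδ2 hδpos
  intro s hs
  have hs1 : s ∈ Metric.thickening ρ₁ (((↑) : ℝ → ℂ) '' Set.Icc (1:ℝ) (Real.sqrt 2)) :=
    Metric.thickening_mono (min_le_left _ _) _ hs
  refine ⟨hδ1 s hs1, ?_⟩
  -- a real base point `t` within `ρ` of `s`
  obtain ⟨t, ht, hst⟩ := reduction_exists_real_near_of_mem_thickening hs
  -- `M ≥ 0` from the jet bound at order 0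
  have hM : 0 ≤ M := by
    have h := hδ2 t ht 0
    simp only [Nat.factorial_zero, Nat.cast_one, mul_one, pow_zero] at h
    exact (norm_nonneg _).trans h
  -- `P_δ` is holomorphic on the disc `|z - t| < ρ₁ ⊆ T_ρ₁` (no zero of `Z_δ` there)
  have hfin := finite_powerset_edgeSet R.isBounded hδpos
  have hdiff := differentiableOn_ratio hfin
    (Literature.Probability.Percolation.discreteCrossing R.carrier δ (R.arc 0) (R.arc 2))
    (fun ω ↦ ω.ncard + 2 * Nat.card ((Literature.Probability.Percolation.openGraph ω ⊔
      Literature.Probability.LatticeModels.wired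
        (Literature.Probability.LatticeModels.discreteArc R.carrier δ (R.arc 0) ∪
          Literature.Probability.LatticeModels.discreteArc R.carrier δ (R.arc 2))).induce
      (Literature.Probability.LatticeModels.meshDomain R.carrier δ)).ConnectedComponent)
    (U := Metric.ball (t : ℂ) ρ₁) fun z hz => hδ1 z (jets_ball_ofReal_subset_thickening ht ρ₁ hz)
  have hsball : s ∈ Metric.ball (t : ℂ) ρ₁ :=
    Metric.mem_ball.2 (hst.trans_le (min_le_left _ _))
  have hsA : A * ‖s - (t : ℂ)‖ ≤ 1 / 2 := by
    have hst' : ‖s - (t : ℂ)‖ < 1 / (2 * (A + 1)) := by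
      rw [← dist_eq_norm]; exact hst.trans_le (min_le_right _ _)
    have hA' : A * ‖s - (t : ℂ)‖ ≤ A * (1 / (2 * (A + 1))) :=
      mul_le_mul_of_nonneg_left hst'.le hA
    have hfrac : A * (1 / (2 * (A + 1))) ≤ 1 / 2 := by
      rw [mul_one_div, div_le_div_iff₀ hA1 two_pos]
      nlinarith
    exact hA'.trans hfrac
  exact reduction_norm_le_of_jets hdiff hM hA (hδ2 t ht) hsball hsA

/-- **The crux implies arc zero-freeness** (`UniformZeroFree → stub_arcZeroFree`): the first
conjunct of the crux, with the same `ρ`. [folklore] -/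
theorem arcZeroFree_of_uniformZeroFree : Summit.CriticalPhenomena.CardyFormulaZ2.Theses.CardyQContinuation.UniformZeroFree → (∀ R : Literature.Probability.RandomPlanarGeometry.ConformalRectangle, ∃ ρ > (0:ℝ), ∀ᶠ δ in nhdsWithin (0:ℝ) (Set.Ioi 0), ∀ s ∈ Metric.thickening ρ (((↑) : ℝ → ℂ) '' Set.Icc (1:ℝ) (Real.sqrt 2)), (∑ᶠ ω ∈ 𝒫 (Literature.Probability.LatticeModels.discreteDomainGraph R.carrier δ).edgeSet, s ^ (ω.ncard + 2 * Nat.card ((Literature.Probability.Percolation.openGraph ω ⊔ Literature.Probability.LatticeModels.wired (Literature.Probability.LatticeModels.discreteArc R.carrier δ (R.arc 0) ∪ Literature.Probability.LatticeModels.discreteArc R.carrier δ (R.arc 2))).induce (Literature.Probability.LatticeModels.meshDomain R.carrier δ)).ConnectedComponent)) ≠ 0) := by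
  intro hU
  dsimp only [Summit.CriticalPhenomena.CardyFormulaZ2.Theses.CardyQContinuation.UniformZeroFree] at hU
  intro R
  obtain ⟨ρ, hρ, M, hev⟩ := hU R
  refine ⟨ρ, hρ, ?_⟩
  filter_upwards [hev] with δ hδ
  exact fun s hs => (hδ s hs).1

/-- **`UniformZeroFree` ⇔ `stub_arcZeroFree ∧ stub_jetsBounded`.** The crux of the route is
equivalent to the conjunction of the two registered stubs of the line `registered` (skeleton v2):
`⇐` is `uniformZeroFree_of_arcZeroFree_of_jetsBounded` (Taylor expansion at real points), `⇒` is
the first conjunct together with Cauchy's estimates on the discs `|s − t| < ρ ⊆ T_ρ`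
(`jetsBounded_of_uniformZeroFree`, file `…UniformZeroFreeJets`).  So the cut loses nothing: the
crux is refuted by refuting either stub, and it inherits their necessary conditions (e.g. the route
item `FirstJetAtOneBounded`, stmt-CriticalPhenomena-7102, via `jets_firstJetAtOneBounded`).
[folklore] -/
theorem uniformZeroFree_iff_arcZeroFree_and_jetsBounded : Summit.CriticalPhenomena.CardyFormulaZ2.Theses.CardyQContinuation.UniformZeroFree ↔ (∀ R : Literature.Probability.RandomPlanarGeometry.ConformalRectangle, ∃ ρ > (0:ℝ), ∀ᶠ δ in nhdsWithin (0:ℝ) (Set.Ioi 0), ∀ s ∈ Metric.thickening ρ (((↑) : ℝ → ℂ) '' Set.Icc (1:ℝ) (Real.sqrt 2)), (∑ᶠ ω ∈ 𝒫 (Literature.Probability.LatticeModels.discreteDomainGraph R.carrier δ).edgeSet, s ^ (ω.ncard + 2 * Nat.card ((Literature.Probability.Percolation.openGraph ω ⊔ Literature.Probability.LatticeModels.wired (Literature.Probability.LatticeModels.discreteArc R.carrier δ (R.arc 0) ∪ Literature.Probability.LatticeModels.discreteArc R.carrier δ (R.arc 2))).induce (Literature.Probability.LatticeModels.meshDomain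 R.carrier δ)).ConnectedComponent)) ≠ 0) ∧ (∀ R : Literature.Probability.RandomPlanarGeometry.ConformalRectangle, ∃ M A : ℝ, 0 ≤ A ∧ ∀ᶠ δ in nhdsWithin (0:ℝ) (Set.Ioi 0), ∀ t ∈ Set.Icc (1:ℝ) (Real.sqrt 2), ∀ k : ℕ, ‖iteratedDeriv k (fun s ↦ (∑ᶠ ω ∈ 𝒫 (Literature.Probability.LatticeModels.discreteDomainGraph R.carrier δ).edgeSet, (Literature.Probability.Percolation.discreteCrossing R.carrier δ (R.arc 0) (R.arc 2)).indicator (fun ω ↦ s ^ (ω.ncard + 2 * Nat.card ((Literature.Probability.Percolation.openGraph ω ⊔ Literature.Probability.LatticeModels.wired (Literature.Probability.LatticeModels.discreteArc R.carrier δ (R.arc 0) ∪ Literature.Probability.LatticeModels.discreteArc R.carrier δ (R.arc 2))).induce (Literature.Probability.LatticeModels.meshDomain R.carrier δ)).ConnectedComponent)) ω) / (∑ᶠ ω ∈ 𝒫 (Literature.Probability.LatticeModels.discreteDomainGraph R.carrier δ).edgeSet, s ^ (ω.ncard + 2 * Nat.card ((Literature.Probability.Percolation.openGraph ω ⊔ Literature.Probability.LatticeModels.wired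 (Literature.Probability.LatticeModels.discreteArc R.carrier δ (R.arc 0) ∪ Literature.Probability.LatticeModels.discreteArc R.carrier δ (R.arc 2))).induce (Literature.Probability.LatticeModels.meshDomain R.carrier δ)).ConnectedComponent))) (t : ℂ)‖ ≤ M * (k.factorial : ℝ) * A ^ k) := by
  constructor
  · intro hU
    refine ⟨arcZeroFree_of_uniformZeroFree hU, ?_⟩
    have hJ := jetsBounded_of_uniformZeroFree hU
    dsimp only at hJ
    exact hJ
  · rintro ⟨h1, h2⟩
    exact uniformZeroFree_of_arcZeroFree_of_jetsBounded h1 h2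

end Summit.CriticalPhenomena.CardyFormulaZ2.Theorems.UniformZeroFree
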